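import Summits.ValiantsHypothesis.ValiantsHypothesis.Theorems.KPlusLogSqLawTridiagonalRealStaticUnitSixConcordant

/-!
# Route «KPlusLogSqLaw», crux `WeakLifting` (stmt-ValiantsHypothesis-19561) — REAL side of the tridiagonal sector:
# the UNIT-COEFFICIENT sub-sector at size `6` — the SHARP CONCORDANT-SIDE LAW: zero or one zero, decided by `L₂` against `(L₁−L₀)₊ + (L₃−L₄)₊`

HONEST FRAMING.  Helper theorems (`--supports stmt-ValiantsHypothesis-19561 --as helper`), seat val-sym-lift-p1 (g17), cell `pub-symmetroid`,
2026-08-28; sequel of `…UnitSixConcordant` (strict log-convexity of the secular factors `1 + x^{L₁}/(x^{L₀} − 1)` in `ln x`; at most two zeros on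
the concordant side).  Slopes `L_t = 2f_t − d_t − d_{t+1}`, `b_t = x^{L_t}`; on `(1, ∞)` with `L₀, L₄ > 0` the root equation is
`Φ(x) := (1 + b₁/(b₀ − 1))(1 + b₃/(b₄ − 1)) = b₂`.  Proved here, for ALL exponent data with `L₀, L₄ > 0`, writing
`s := max(L₁ − L₀, 0) + max(L₃ − L₄, 0)`:
* `one_add_secular_factor_gt`, `one_add_secular_factor_le` — `x^{max(L₁−L₀,0)} < 1 + b₁/(b₀ − 1) ≤ 3·x^{max(L₁−L₀,0)}` (`x ≥ 2` for the upper bound);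
* **NO ZERO above `1` when `L₂ ≤ s`** (`card_posRoots_gt_one_unit_six_eq_zero_of_le`): then `Φ(x) > x^s ≥ x^{L₂}` on `(1, ∞)`;
* **EXACTLY ONE zero above `1` when `L₂ > s`** (`card_posRoots_gt_one_unit_six_eq_one_of_gt`): existence from `D₆(1) = 1 > 0 > D₆(10)` (there
  `Φ(10) ≤ 9·10^s < 10^{L₂}`), uniqueness from strict log-convexity: two zeros `x₁ < x₂` force `Φ(x₃) > x₃^{L₂}` at every `x₃ > x₂`, contradicting
  `Φ(x₃) ≤ 9 x₃^s < x₃^{L₂}` at `x₃ = x₂ + 10`.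
Hence on the CONCORDANT side the count is EXACTLY `[L₂ > (L₁−L₀)₊ + (L₃−L₄)₊] ∈ {0, 1}` (mirror below `1` for `L₀, L₄ < 0` by `x ↦ 1/x`, not restated);
this explains the located census columns «above ∈ {0,1}» of the classes `+++++`, `+++−+` and «above ≡ 1 / ≡ 0» of `+−+−+`, `++−++`, `++−−+`,
`+−−−+` (memo U6-CHAMBERS-liftp1g17.md §3).  Nothing here is an upper law for the register (α NO MOVER); nothing bears on `WeakLifting` /
`TropicalB` (stmt-19771) in their windows, Conjecture B, the Door-A registers, `MatrixDescartes` (stmt-18050) or VP ≠ VNP.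
[this seat; folklore: log-convexity, intermediate value theorem]
-/

-- `Summit.ValiantsHypothesis.ValiantsHypothesis.…` repeats a component by the D-0017 layout (single-conjunct summit); the name is mandated.
set_option linter.dupNamespace false
set_option autoImplicit false

namespace Summit.ValiantsHypothesis.ValiantsHypothesis.Theorems.KPlusLogSqLaw
namespace StaticTridiagonalRealUnit

open Polynomial Finset
open Summit.ValiantsHypothesis.ValiantsHypothesis.Theorems.KPlusLogSqLaw.StaticTridiagonalRealPotential (pathDet)
open Summit.ValiantsHypothesis.ValiantsHypothesis.Theorems.KPlusLogSqLaw.DefiniteInterpolation (exists_rpow_interp)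

variable (d : ℕ → ℕ) (f : ℕ → ℕ)

/-! ### Two-sided monomial bounds for the secular factor on `(1, ∞)` -/

/-- lower bound: `x^{max(L₁−L₀,0)} < 1 + x^{L₁}/(x^{L₀} − 1)` for `x > 1`, `L₀ > 0`. [elementary] -/
theorem one_add_secular_factor_gt (L₀ L₁ : ℤ) (h0 : 0 < L₀) {x : ℝ} (hx : 1 < x) :
    x ^ max (L₁ - L₀) 0 < 1 + x ^ L₁ / (x ^ L₀ - 1) := by
  have hx0 : 0 < x := one_pos.trans hx
  have c : 0 < x ^ L₀ - 1 := sub_pos.2 (one_lt_zpow₀ hx h0)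
  have k : 0 < x ^ L₁ / (x ^ L₀ - 1) := div_pos (zpow_pos hx0 _) c
  rcases le_or_gt (L₁ - L₀) 0 with h | h
  · rw [max_eq_right h, zpow_zero]; linarith
  · rw [max_eq_left h.le]
    -- `x^{L₁−L₀} = x^{L₁}/x^{L₀} < x^{L₁}/(x^{L₀} − 1) < 1 + …`
    have e : x ^ (L₁ - L₀) = x ^ L₁ / x ^ L₀ := zpow_sub₀ hx0.ne' _ _
    rw [e]
    have h1 : x ^ L₁ / x ^ L₀ < x ^ L₁ / (x ^ L₀ - 1) :=
      div_lt_div_of_pos_left (zpow_pos hx0 _) c (by linarith)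
    linarith

/-- upper bound: `1 + x^{L₁}/(x^{L₀} − 1) ≤ 3·x^{max(L₁−L₀,0)}` for `x ≥ 2`, `L₀ > 0` (there `x^{L₀} − 1 ≥ x^{L₀}/2`). [elementary] -/
theorem one_add_secular_factor_le (L₀ L₁ : ℤ) (h0 : 0 < L₀) {x : ℝ} (hx : 2 ≤ x) :
    1 + x ^ L₁ / (x ^ L₀ - 1) ≤ 3 * x ^ max (L₁ - L₀) 0 := by
  have hx1 : 1 < x := by linarith
  have hx0 : 0 < x := by linarith
  have hL : (2 : ℝ) ≤ x ^ L₀ := by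
    have h2 : (2 : ℝ) ^ L₀ ≤ x ^ L₀ := zpow_le_zpow_left₀ h0.le (by norm_num) hx
    have h3 : (2 : ℝ) ≤ (2 : ℝ) ^ L₀ := by
      have := zpow_le_zpow_right₀ (show (1:ℝ) ≤ 2 by norm_num) (show (1 : ℤ) ≤ L₀ by omega)
      rwa [zpow_one] at this
    linarith
  have c : 0 < x ^ L₀ - 1 := by linarith
  -- `x^{L₁}/(x^{L₀} − 1) ≤ 2 x^{L₁}/x^{L₀} = 2 x^{L₁−L₀} ≤ 2 x^{max}` and `1 ≤ x^{max}`
  have h1 : x ^ L₁ / (x ^ L₀ - 1) ≤ 2 * x ^ (L₁ - L₀) := by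
    rw [zpow_sub₀ hx0.ne', ← mul_div_assoc, div_le_div_iff₀ c (zpow_pos hx0 _)]
    nlinarith [mul_nonneg (zpow_pos hx0 L₁).le (sub_nonneg.2 hL), zpow_pos hx0 L₀]
  have h2 : x ^ (L₁ - L₀) ≤ x ^ max (L₁ - L₀) 0 := zpow_le_zpow_right₀ hx1.le (le_max_left _ _)
  have h3 : (1 : ℝ) ≤ x ^ max (L₁ - L₀) 0 := one_le_zpow₀ hx1.le (le_max_right _ _)
  linarith

/-- the product bounds: `x^s < Φ(x)` on `(1, ∞)` and `Φ(x) ≤ 9 x^s` for `x ≥ 2`, `s = max(L₁−L₀,0) + max(L₃−L₄,0)`. [this file] -/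
theorem secular_product_bounds (L₀ L₁ L₃ L₄ : ℤ) (h0 : 0 < L₀) (h4 : 0 < L₄) {x : ℝ} (hx : 1 < x) :
    x ^ (max (L₁ - L₀) 0 + max (L₃ - L₄) 0) < (1 + x ^ L₁ / (x ^ L₀ - 1)) * (1 + x ^ L₃ / (x ^ L₄ - 1)) ∧
      (2 ≤ x → (1 + x ^ L₁ / (x ^ L₀ - 1)) * (1 + x ^ L₃ / (x ^ L₄ - 1)) ≤ 9 * x ^ (max (L₁ - L₀) 0 + max (L₃ - L₄) 0)) := by
  have hx0 : 0 < x := one_pos.trans hx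
  have g0 := one_add_secular_factor_gt L₀ L₁ h0 hx
  have g4 := one_add_secular_factor_gt L₄ L₃ h4 hx
  have p0 := zpow_pos hx0 (max (L₁ - L₀) 0)
  have p4 := zpow_pos hx0 (max (L₃ - L₄) 0)
  refine ⟨?_, fun hx2 => ?_⟩
  · rw [zpow_add₀ hx0.ne']
    exact mul_lt_mul'' g0 g4 p0.le p4.le
  · have u0 := one_add_secular_factor_le L₀ L₁ h0 hx2
    have u4 := one_add_secular_factor_le L₄ L₃ h4 hx2
    rw [zpow_add₀ hx0.ne']
    nlinarith [mul_le_mul u0 u4 (by linarith) (by linarith)]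

/-! ### No zero above `1` when `L₂ ≤ s` -/

/-- **CONCORDANT SIDE, EMPTY CASE**: `L₀, L₄ > 0` and `L₂ ≤ max(L₁−L₀,0) + max(L₃−L₄,0)` ⇒ no determinant zero in `(1, ∞)`. [this file] -/
theorem card_posRoots_gt_one_unit_six_eq_zero_of_le
    (h0 : 0 < (2 * f 0 : ℤ) - d 0 - d 1) (h4 : 0 < (2 * f 4 : ℤ) - d 4 - d 5)
    (hs : (2 * f 2 : ℤ) - d 2 - d 3 ≤ max (((2 * f 1 : ℤ) - d 1 - d 2) - ((2 * f 0 : ℤ) - d 0 - d 1)) 0 +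
      max (((2 * f 3 : ℤ) - d 3 - d 4) - ((2 * f 4 : ℤ) - d 4 - d 5)) 0) :
    ((pathDet (fun _ => (1 : ℝ)) d (fun _ => (1 : ℝ)) f 6).roots.toFinset.filter (fun x => 1 < x)).card = 0 := by
  rw [Finset.card_eq_zero, Finset.eq_empty_iff_forall_notMem]
  intro x hx
  simp only [Finset.mem_filter, Multiset.mem_toFinset, mem_roots', IsRoot.def] at hx
  obtain ⟨⟨-, hr⟩, hx1⟩ := hx
  have hx0 : 0 < x := one_pos.trans hx1
  have sec := unit_six_secular_gt_one _ _ _ _ _ h0 h4 hx1 (unit_six_root_eq d f hx0 hr)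
  have lb := (secular_product_bounds ((2 * f 0 : ℤ) - d 0 - d 1) ((2 * f 1 : ℤ) - d 1 - d 2) ((2 * f 3 : ℤ) - d 3 - d 4)
    ((2 * f 4 : ℤ) - d 4 - d 5) h0 h4 hx1).1
  rw [sec] at lb
  exact absurd (zpow_le_zpow_right₀ hx1.le hs) (not_le.2 lb)

/-! ### Exactly one zero above `1` when `L₂ > s` -/

/-- uniqueness: with `L₂ > s`, two zeros `1 < x₁ < x₂` are impossible — strict log-convexity would force `Φ(x₃) > x₃^{L₂}` at `x₃ = x₂ + 10`,
against `Φ(x₃) ≤ 9 x₃^s < x₃^{L₂}`. [this file] -/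
theorem unit_six_concordant_no_two (L₀ L₁ L₂ L₃ L₄ : ℤ) (h0 : 0 < L₀) (h4 : 0 < L₄)
    (hs : max (L₁ - L₀) 0 + max (L₃ - L₄) 0 < L₂) {x y : ℝ} (hx : 1 < x) (hxy : x < y)
    (hxr : (1 - x ^ L₀ - x ^ L₁) * (1 - x ^ L₃ - x ^ L₄) = x ^ L₂ * (1 - x ^ L₀) * (1 - x ^ L₄))
    (hyr : (1 - y ^ L₀ - y ^ L₁) * (1 - y ^ L₃ - y ^ L₄) = y ^ L₂ * (1 - y ^ L₀) * (1 - y ^ L₄)) : False := by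
  set s := max (L₁ - L₀) 0 + max (L₃ - L₄) 0 with hsdef
  have hx0 : 0 < x := one_pos.trans hx
  have hy : 1 < y := hx.trans hxy
  have hy0 : 0 < y := hx0.trans hxy
  set z := y + 10 with hzdef
  have hyz : y < z := by simp [hzdef]
  have hz : 1 < z := hy.trans hyz
  have hz0 : 0 < z := hy0.trans hyz
  have hz2 : (2 : ℝ) ≤ z := by linarith
  have hz10 : (10 : ℝ) ≤ z := by linarith
  obtain ⟨p, q, hp, hq, hpq, hyw⟩ := exists_rpow_interp hx0 hxy hyz
  have fx := unit_six_secular_gt_one L₀ L₁ L₂ L₃ L₄ h0 h4 hx hxr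
  have fy := unit_six_secular_gt_one L₀ L₁ L₂ L₃ L₄ h0 h4 hy hyr
  have hxz : x < z := hxy.trans hyz
  have g0 := one_add_secular_factor_logConvex L₀ L₁ h0 hx hxz hp hq hpq
  have g4 := one_add_secular_factor_logConvex L₄ L₃ h4 hx hxz hp hq hpq
  rw [hyw] at g0 g4
  have cx : 0 < x ^ L₀ - 1 := sub_pos.2 (one_lt_zpow₀ hx h0)
  have dx : 0 < x ^ L₄ - 1 := sub_pos.2 (one_lt_zpow₀ hx h4)
  have cz : 0 < z ^ L₀ - 1 := sub_pos.2 (one_lt_zpow₀ hz h0)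
  have dz : 0 < z ^ L₄ - 1 := sub_pos.2 (one_lt_zpow₀ hz h4)
  have cy : 0 < y ^ L₀ - 1 := sub_pos.2 (one_lt_zpow₀ hy h0)
  have dy : 0 < y ^ L₄ - 1 := sub_pos.2 (one_lt_zpow₀ hy h4)
  have ax : 0 < 1 + x ^ L₁ / (x ^ L₀ - 1) := by positivity
  have bx : 0 < 1 + x ^ L₃ / (x ^ L₄ - 1) := by positivity
  have az : 0 < 1 + z ^ L₁ / (z ^ L₀ - 1) := by positivity
  have bz : 0 < 1 + z ^ L₃ / (z ^ L₄ - 1) := by positivity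
  have ay : 0 < 1 + y ^ L₁ / (y ^ L₀ - 1) := by positivity
  have prod : (1 + y ^ L₁ / (y ^ L₀ - 1)) * (1 + y ^ L₃ / (y ^ L₄ - 1)) <
      ((1 + x ^ L₁ / (x ^ L₀ - 1)) * (1 + x ^ L₃ / (x ^ L₄ - 1))) ^ p *
        ((1 + z ^ L₁ / (z ^ L₀ - 1)) * (1 + z ^ L₃ / (z ^ L₄ - 1))) ^ q := by
    have := mul_lt_mul'' g0 g4 ay.le (by positivity)
    rw [Real.mul_rpow ax.le bx.le, Real.mul_rpow az.le bz.le]; linarith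
  rw [fx, fy] at prod
  -- `y^{L₂} = (x^{L₂})^p (z^{L₂})^q`, so `(z^{L₂})^q < Φ(z)^q`, i.e. `z^{L₂} < Φ(z)`
  set Φz := (1 + z ^ L₁ / (z ^ L₀ - 1)) * (1 + z ^ L₃ / (z ^ L₄ - 1)) with hΦz
  have hΦz0 : 0 < Φz := by positivity
  have e : y ^ L₂ = (x ^ L₂) ^ p * (z ^ L₂) ^ q := by rw [← hyw]; exact zpow_interp hx0 hz0 p q L₂
  rw [e] at prod
  have hxp : 0 < (x ^ L₂) ^ p := Real.rpow_pos_of_pos (zpow_pos hx0 _) p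
  have hq' : (z ^ L₂) ^ q < Φz ^ q := lt_of_mul_lt_mul_left prod hxp.le
  have hlt : z ^ L₂ < Φz := (Real.rpow_lt_rpow_iff (zpow_pos hz0 _).le hΦz0.le hq).1 hq'
  -- but `Φ(z) ≤ 9 z^s < 10 z^s ≤ z^{s+1} ≤ z^{L₂}`
  have ub := (secular_product_bounds L₀ L₁ L₃ L₄ h0 h4 hz).2 hz2
  have hs1 : z ^ (s + 1) ≤ z ^ L₂ := zpow_le_zpow_right₀ hz.le (by omega)
  rw [zpow_add_one₀ hz0.ne'] at hs1
  have ps := zpow_pos hz0 s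
  nlinarith

/-- in the case `L₂ > s` the determinant is NEGATIVE at `x = 10` (uniformly in the exponents). [this file] -/
theorem unit_six_concordant_eval_ten_neg
    (h0 : 0 < (2 * f 0 : ℤ) - d 0 - d 1) (h4 : 0 < (2 * f 4 : ℤ) - d 4 - d 5)
    (hs : max (((2 * f 1 : ℤ) - d 1 - d 2) - ((2 * f 0 : ℤ) - d 0 - d 1)) 0 +
      max (((2 * f 3 : ℤ) - d 3 - d 4) - ((2 * f 4 : ℤ) - d 4 - d 5)) 0 < (2 * f 2 : ℤ) - d 2 - d 3) :
    (pathDet (fun _ => (1 : ℝ)) d (fun _ => (1 : ℝ)) f 6).eval 10 < 0 := by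
  have hq : (10 : ℝ) ≠ 0 := by norm_num
  have hq0 : (0 : ℝ) < 10 := by norm_num
  have hq1 : (1 : ℝ) < 10 := by norm_num
  rw [eval_unit_six_eq d f _ hq]
  set L₀ := (2 * f 0 : ℤ) - d 0 - d 1
  set L₁ := (2 * f 1 : ℤ) - d 1 - d 2
  set L₂ := (2 * f 2 : ℤ) - d 2 - d 3
  set L₃ := (2 * f 3 : ℤ) - d 3 - d 4
  set L₄ := (2 * f 4 : ℤ) - d 4 - d 5
  set s := max (L₁ - L₀) 0 + max (L₃ - L₄) 0 with hsdef
  have c : 0 < (10 : ℝ) ^ L₀ - 1 := sub_pos.2 (one_lt_zpow₀ hq1 h0)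
  have dd : 0 < (10 : ℝ) ^ L₄ - 1 := sub_pos.2 (one_lt_zpow₀ hq1 h4)
  obtain ⟨-, ub⟩ := secular_product_bounds L₀ L₁ L₃ L₄ h0 h4 hq1
  have ub := ub (by norm_num)
  have hs1 : (10 : ℝ) ^ (s + 1) ≤ (10 : ℝ) ^ L₂ := zpow_le_zpow_right₀ hq1.le (by omega)
  rw [zpow_add_one₀ hq] at hs1
  have ps := zpow_pos hq0 s
  have hE : (0 : ℝ) < (10 : ℝ) ^ (d 0 + d 1 + d 2 + d 3 + d 4 + d 5) := pow_pos hq0 _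
  apply mul_neg_of_pos_of_neg hE
  -- gauge expression `= CD · (Φ − b₂)` with `CD = (b₀ − 1)(b₄ − 1) > 0` and `Φ ≤ 9·10^s < 10^{L₂} = b₂`
  have e : (1 - (10 : ℝ) ^ L₀ - (10 : ℝ) ^ L₁) * (1 - (10 : ℝ) ^ L₃ - (10 : ℝ) ^ L₄) -
      (10 : ℝ) ^ L₂ * (1 - (10 : ℝ) ^ L₀) * (1 - (10 : ℝ) ^ L₄) =
      (((10 : ℝ) ^ L₀ - 1) * ((10 : ℝ) ^ L₄ - 1)) *
        ((1 + (10 : ℝ) ^ L₁ / ((10 : ℝ) ^ L₀ - 1)) * (1 + (10 : ℝ) ^ L₃ / ((10 : ℝ) ^ L₄ - 1)) - (10 : ℝ) ^ L₂) := by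
    field_simp
    ring
  rw [e]
  exact mul_neg_of_pos_of_neg (mul_pos c dd) (by nlinarith)

/-- **CONCORDANT SIDE, EXACTLY-ONE CASE**: `L₀, L₄ > 0` and `L₂ > max(L₁−L₀,0) + max(L₃−L₄,0)` ⇒ EXACTLY ONE determinant zero in `(1, ∞)`
(it lies in `(1, 10)`). [this file] -/
theorem card_posRoots_gt_one_unit_six_eq_one_of_gt
    (h0 : 0 < (2 * f 0 : ℤ) - d 0 - d 1) (h4 : 0 < (2 * f 4 : ℤ) - d 4 - d 5)
    (hs : max (((2 * f 1 : ℤ) - d 1 - d 2) - ((2 * f 0 : ℤ) - d 0 - d 1)) 0 +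
      max (((2 * f 3 : ℤ) - d 3 - d 4) - ((2 * f 4 : ℤ) - d 4 - d 5)) 0 < (2 * f 2 : ℤ) - d 2 - d 3) :
    ((pathDet (fun _ => (1 : ℝ)) d (fun _ => (1 : ℝ)) f 6).roots.toFinset.filter (fun x => 1 < x)).card = 1 := by
  set P := pathDet (fun _ => (1 : ℝ)) d (fun _ => (1 : ℝ)) f 6 with hP
  set S := P.roots.toFinset.filter (fun x => 1 < x) with hS
  have hpos : 0 < P.eval 1 := by rw [hP, eval_unit_six_one]; exact one_pos
  have hneg := unit_six_concordant_eval_ten_neg d f h0 h4 hs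
  have hcont : ContinuousOn (fun x => P.eval x) (Set.Icc (1 : ℝ) 10) := P.continuous.continuousOn
  obtain ⟨r, ⟨hr1, hr2⟩, hr⟩ := intermediate_value_Ioo' (show (1 : ℝ) ≤ 10 by norm_num) hcont ⟨hneg, hpos⟩
  have hrS : r ∈ S := by
    simp only [hS, Finset.mem_filter, Multiset.mem_toFinset, mem_roots', IsRoot.def]
    exact ⟨⟨unit_six_ne_zero d f, hr⟩, hr1⟩
  have mem : ∀ x, x ∈ S → 1 < x ∧ P.eval x = 0 := by
    intro x hx
    simp only [hS, Finset.mem_filter, Multiset.mem_toFinset, mem_roots', IsRoot.def] at hx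
    exact ⟨hx.2, hx.1.2⟩
  have hle : S.card ≤ 1 := Finset.card_le_one.2 fun x hx y hy => by
    obtain ⟨hx1, hxr⟩ := mem x hx
    obtain ⟨hy1, hyr⟩ := mem y hy
    have hx0 : 0 < x := one_pos.trans hx1
    have hy0 : 0 < y := one_pos.trans hy1
    by_contra hne
    rcases lt_or_gt_of_ne hne with hlt | hgt
    · exact unit_six_concordant_no_two _ _ _ _ _ h0 h4 hs hx1 hlt (unit_six_root_eq d f hx0 hxr) (unit_six_root_eq d f hy0 hyr)
    · exact unit_six_concordant_no_two _ _ _ _ _ h0 h4 hs hy1 hgt (unit_six_root_eq d f hy0 hyr) (unit_six_root_eq d f hx0 hxr)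
  have hge : 1 ≤ S.card := Finset.card_pos.2 ⟨r, hrS⟩
  omega

end StaticTridiagonalRealUnit
end Summit.ValiantsHypothesis.ValiantsHypothesis.Theorems.KPlusLogSqLaw
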